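import Literature.Geometry.Kaehler.RiemannSurfaceLoopDifferentials
import Mathlib.LinearAlgebra.Matrix.BilinearForm
import HarnessLib

/-!
# The Riemann form of the Jacobian is non-degenerate; its integral Gram matrix on the period lattice
# (Lange, *Abelian Varieties over the Complex Numbers*, §4.1 (type of a polarization), §4.1.2)

Layer `Literature/Geometry/Kaehler`, sequel of `RiemannSurfaceJacobianPolarization` (the Riemann form
`E = jacobianRiemannForm w` of `ℂ^g/Π ℤ^{2g} ≅ Jac(M)`, `E = 2B` for the real bilinear form
`B = jacobianBilin w`) and `RiemannSurfaceLoopDifferentials` (the explicit integers `E(∫_γ, ∫_δ)`).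

Lange (2023), §4.1: a polarization is «a positive definite Hermitian form `H` whose imaginary part
`E = Im H` is integral on `Λ`»; `E` is then a NON-DEGENERATE alternating form on `Λ` and its elementary
divisors `(d₁, …, d_g)` are the type.  Here, for the canonical polarization of the Jacobian of a
compact connected Riemann surface:

* §1 `E(z', z) = -E(z, z')`, `E = 2B`, and **non-degeneracy on `ℂ^g`** (`jacobianBilin_nondegenerate`,
  `jacobianRiemannForm_nondegenerate`: `E(iz, z) > 0` for `z ≠ 0`);
* §2 **the Gram matrix on the `ℤ`-basis `c` of the period lattice**: the real matrix
  `periodGram x₀ w c = (E(Π e_i, Π e_j))` has non-zero determinant (`det_periodGram_ne_zero`, from the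
  real basis `periodBasis` of `ℂ^g` formed by the period vectors) and is an antisymmetric INTEGER matrix
  (`periodGramInt`, `det_periodGramInt_ne_zero`, `periodGramInt_transpose`) — packaged as
  **`exists_int_gram_jacobianRiemannForm`**: `E|_Λ` is a non-degenerate integral alternating form.

Everything is proved; no named facts, no instances.

## References

* H. Lange, *Abelian Varieties over the Complex Numbers*, Springer (2023), §4.1 (polarizations and their
  type) and §4.1.2 Proposition 4.1.2. [Lange2023AbelianVarietiesComplex]
* O. Forster, *Lectures on Riemann Surfaces*, GTM 81 (1981), §21.7. [Forster1981]
-/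

noncomputable section

open scoped Manifold ContDiff Topology ComplexConjugate Real
open Set Filter Function Complex
open Literature.NumberTheory.Transcendental Literature.Analysis.Complex Literature.Topology.CoveringSpaces

namespace Literature.Geometry.Kaehler

namespace RiemannSurface

open MeromorphicOneForm ComplexTorus

universe u

variable {M : Type u} [TopologicalSpace M] [ChartedSpace ℂ M]

variable [ConnectedSpace M] [IsManifold 𝓘(ℂ, ℂ) ω M] [IsManifold 𝓘(ℝ, ℂ) ∞ M] [CompactSpace M]
  [T2Space M] [Fact (Module.finrank ℝ ℂ = 2)]
  {σ : Type*} [Fintype σ] [DecidableEq σ] (w : Module.Basis σ ℂ ↥(holomorphicOneForms M))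

/-! ### §1 Antisymmetry, `E = 2B`, non-degeneracy -/

/-- `E = 2B`: the Riemann form is twice the bilinear form `B(z, z') = (C/2) Re ⟪ω_{z'}, ω_z⟫`.
[cite: Lange2023AbelianVarietiesComplex, §4.1.2 Proposition 4.1.2] -/
theorem jacobianRiemannForm_eq_two_mul_jacobianBilin (z z' : σ → ℂ) :
    jacobianRiemannForm w ![z, z'] = 2 * jacobianBilin w z z' := by
  rw [jacobianRiemannForm_apply, jacobianBilin_apply]
  ring

/-- **Antisymmetry** `E(z', z) = -E(z, z')`. [cite: Lange2023AbelianVarietiesComplex, §4.1] -/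
theorem jacobianRiemannForm_swap (z z' : σ → ℂ) :
    jacobianRiemannForm w ![z', z] = -jacobianRiemannForm w ![z, z'] := by
  rw [jacobianRiemannForm, realTwoForm_apply, realTwoForm_apply]
  ring

/-- `B(z', z) = -B(z, z')`. [cite: Lange2023AbelianVarietiesComplex, §4.1] -/
theorem jacobianBilin_swap (z z' : σ → ℂ) : jacobianBilin w z' z = -jacobianBilin w z z' := by
  have h := jacobianRiemannForm_swap w z z'
  rw [jacobianRiemannForm_eq_two_mul_jacobianBilin, jacobianRiemannForm_eq_two_mul_jacobianBilin] at h
  linarith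

/-- `E(z, z) = 0`. [cite: Lange2023AbelianVarietiesComplex, §4.1] -/
theorem jacobianRiemannForm_self (z : σ → ℂ) : jacobianRiemannForm w ![z, z] = 0 := by
  have h := jacobianRiemannForm_swap w z z
  linarith

/-- **Non-degeneracy of `E` on `ℂ^g`**: `E(z, ·) = 0` forces `z = 0` (`E(iz, z) > 0` otherwise).
[cite: Lange2023AbelianVarietiesComplex, §4.1 and §2.1 Lemma 2.1.7] -/
theorem jacobianRiemannForm_nondegenerate {z : σ → ℂ} (hz : ∀ z' : σ → ℂ, jacobianRiemannForm w ![z, z'] = 0) :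
    z = 0 := by
  by_contra hne
  have hpos := jacobianRiemannForm_pos w hne
  rw [jacobianRiemannForm_swap, hz, neg_zero] at hpos
  exact lt_irrefl _ hpos

/-- **`B` is a non-degenerate real bilinear form on `ℂ^g`.** [cite: Lange2023AbelianVarietiesComplex, §4.1] -/
theorem jacobianBilin_nondegenerate : (jacobianBilin w).Nondegenerate := by
  refine ⟨fun z hz ↦ jacobianRiemannForm_nondegenerate w fun z' ↦ ?_,
    fun z hz ↦ jacobianRiemannForm_nondegenerate w fun z' ↦ ?_⟩
  · rw [jacobianRiemannForm_eq_two_mul_jacobianBilin, hz z', mul_zero]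
  · rw [jacobianRiemannForm_eq_two_mul_jacobianBilin, jacobianBilin_swap, hz z', neg_zero, mul_zero]

/-! ### §2 The Gram matrix on the period lattice -/

section Gram

variable (x₀ : M) {κ : Type*} [Fintype κ] [DecidableEq κ] (c : Module.Basis κ ℤ ↥(periods x₀))

/-- **The Gram matrix of the Riemann form on the `ℤ`-basis `c` of the period lattice**:
`(E(Π e_i, Π e_j))_{ij}`, `Π e_i = (c_i(w_j))_j` the period vectors. [cite: Lange2023AbelianVarietiesComplex, §4.1] -/
def periodGram : Matrix κ κ ℝ := fun i j ↦
  jacobianRiemannForm w ![periodBasis x₀ w c i, periodBasis x₀ w c j]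

omit [DecidableEq κ] in
/-- Entries of the Gram matrix. [cite: Lange2023AbelianVarietiesComplex, §4.1] -/
theorem periodGram_apply (i j : κ) :
    periodGram w x₀ c i j = jacobianRiemannForm w ![periodBasis x₀ w c i, periodBasis x₀ w c j] := rfl

/-- `periodGram = 2 ·` (the matrix of `B` in the real basis of period vectors).
[cite: Lange2023AbelianVarietiesComplex, §4.1] -/
theorem periodGram_eq_two_smul_toMatrix :
    periodGram w x₀ c = (2 : ℝ) • LinearMap.BilinForm.toMatrix (periodBasis x₀ w c) (jacobianBilin w) := by
  ext i j
  rw [periodGram_apply, Matrix.smul_apply, LinearMap.BilinForm.toMatrix_apply, smul_eq_mul,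
    jacobianRiemannForm_eq_two_mul_jacobianBilin]

/-- **`det (E(Π e_i, Π e_j)) ≠ 0`**: the period vectors are a real basis of `ℂ^g` and `E` is
non-degenerate. [cite: Lange2023AbelianVarietiesComplex, §4.1] -/
theorem det_periodGram_ne_zero : (periodGram w x₀ c).det ≠ 0 := by
  rw [periodGram_eq_two_smul_toMatrix, Matrix.det_smul]
  exact mul_ne_zero (pow_ne_zero _ two_ne_zero)
    ((LinearMap.BilinForm.nondegenerate_iff_det_ne_zero (periodBasis x₀ w c)).1 (jacobianBilin_nondegenerate w))

omit [DecidableEq κ] in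
/-- The Gram matrix is antisymmetric. [cite: Lange2023AbelianVarietiesComplex, §4.1] -/
theorem periodGram_transpose : (periodGram w x₀ c).transpose = -periodGram w x₀ c := by
  ext i j
  rw [Matrix.transpose_apply, Matrix.neg_apply, periodGram_apply, periodGram_apply, jacobianRiemannForm_swap]

omit [DecidableEq κ] in
/-- **The entries are integers** (`E` is integral on the period lattice: `E(∫_γ, ∫_δ) = 2 Re ∫_δ η_γ ∈ ℤ`).
[cite: Lange2023AbelianVarietiesComplex, §4.1.2 Proposition 4.1.2] -/
theorem exists_int_periodGram (i j : κ) : ∃ n : ℤ, periodGram w x₀ c i j = n := by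
  obtain ⟨γ, hγ⟩ := mem_periods_iff.1 (c i).2
  obtain ⟨δ, hδ⟩ := mem_periods_iff.1 (c j).2
  obtain ⟨n, hn⟩ := exists_int_jacobianRiemannForm_periodFunctional w x₀ γ δ
  refine ⟨n, ?_⟩
  rw [periodGram_apply, periodBasis_apply, periodBasis_apply, ← hγ, ← hδ, hn]

/-- **The integral Gram matrix** `A ∈ M_{2g}(ℤ)` of `E` on the `ℤ`-basis `c` of the period lattice.
[cite: Lange2023AbelianVarietiesComplex, §4.1] -/
def periodGramInt : Matrix κ κ ℤ := fun i j ↦ Classical.choose (exists_int_periodGram w x₀ c i j)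

omit [DecidableEq κ] in
/-- `(A_{ij} : ℝ) = E(Π e_i, Π e_j)`. [cite: Lange2023AbelianVarietiesComplex, §4.1] -/
theorem cast_periodGramInt (i j : κ) : (periodGramInt w x₀ c i j : ℝ) = periodGram w x₀ c i j :=
  (Classical.choose_spec (exists_int_periodGram w x₀ c i j)).symm

/-- `A` maps to the real Gram matrix. [cite: Lange2023AbelianVarietiesComplex, §4.1] -/
theorem mapMatrix_periodGramInt :
    (Int.castRingHom ℝ).mapMatrix (periodGramInt w x₀ c) = periodGram w x₀ c := by
  ext i j
  exact cast_periodGramInt w x₀ c i j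

/-- **`det A ≠ 0`**: the Riemann form is a non-degenerate integral form on the period lattice.
[cite: Lange2023AbelianVarietiesComplex, §4.1] -/
theorem det_periodGramInt_ne_zero : (periodGramInt w x₀ c).det ≠ 0 := by
  intro h
  have h2 := RingHom.map_det (Int.castRingHom ℝ) (periodGramInt w x₀ c)
  rw [h, map_zero, mapMatrix_periodGramInt] at h2
  exact det_periodGram_ne_zero w x₀ c h2.symm

omit [DecidableEq κ] in
/-- `A` is antisymmetric. [cite: Lange2023AbelianVarietiesComplex, §4.1] -/
theorem periodGramInt_transpose : (periodGramInt w x₀ c).transpose = -periodGramInt w x₀ c := by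
  ext i j
  have h := congrFun (congrFun (periodGram_transpose w x₀ c) i) j
  rw [Matrix.transpose_apply, Matrix.neg_apply] at h ⊢
  exact_mod_cast (by rw [cast_periodGramInt, cast_periodGramInt]; exact h : ((periodGramInt w x₀ c j i : ℤ) : ℝ) =
    -((periodGramInt w x₀ c i j : ℤ) : ℝ))

omit [DecidableEq κ] in
/-- `A_{ii} = 0`. [cite: Lange2023AbelianVarietiesComplex, §4.1] -/
theorem periodGramInt_self (i : κ) : periodGramInt w x₀ c i i = 0 := by
  have h := cast_periodGramInt w x₀ c i i
  rw [periodGram_apply, jacobianRiemannForm_self] at h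
  exact_mod_cast h

/-- **The canonical polarization restricted to the period lattice is a non-degenerate integral
alternating form**: there is an integer matrix `A = (E(Π e_i, Π e_j))` with `Aᵀ = -A`, zero diagonal
and `det A ≠ 0` (so `E|_Λ` has a type `(d₁, …, d_g)`, Lange §4.1).
[cite: Lange2023AbelianVarietiesComplex, §4.1 and §4.1.2 Proposition 4.1.2] -/
theorem exists_int_gram_jacobianRiemannForm :
    ∃ A : Matrix κ κ ℤ,
      (∀ i j, (A i j : ℝ) = jacobianRiemannForm w ![periodBasis x₀ w c i, periodBasis x₀ w c j]) ∧
      A.transpose = -A ∧ (∀ i, A i i = 0) ∧ A.det ≠ 0 :=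
  ⟨periodGramInt w x₀ c, cast_periodGramInt w x₀ c, periodGramInt_transpose w x₀ c,
    periodGramInt_self w x₀ c, det_periodGramInt_ne_zero w x₀ c⟩

end Gram

end RiemannSurface

end Literature.Geometry.Kaehler

end
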